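import Summits.HubbardSuperconductivity.HubbardSuperconductivity.Theses.ThermalWedge
import Summits.HubbardSuperconductivity.HubbardSuperconductivity.Theorems.TwSourcedCondensation.Negative.SourceResponseStructure
import Literature.MathematicalPhysics.QuantumLattice.DuhamelTwoPointProofs
import Literature.MathematicalPhysics.QuantumLattice.ApproximatingHamiltonianProofs
import Literature.MathematicalPhysics.QuantumLattice.DWaveSourceProofs

/-!
# Crux `TwSourcedInertness` (stmt-HubbardSuperconductivity-1696): the zero-source pair
susceptibility law and the linear pair-amplitude response are NECESSARY consequences of the crux

`--supports` file (prover seat 1). The registered line `temperature-for-source-exchange` closes the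
crux from two stubs; its bridge `stub_discCorrection_of_discSusceptibility`
(`ThermalWedgeTwSourcedInertnessDiscCorrectionSusceptibility`) and seat 2's
`tw_thermalDisc_of_discSusceptibility` (`ThermalWedgeTwSourcedInertnessSusceptibility`) show that a
bound `χ_L(β,μ,U,t) ≤ C(1 + log β)` on the Kubo–Mori–Bogoliubov (Duhamel) `d`-wave pair
susceptibility

  `χ_L(β,μ,U,t) := (β/L²)·[Re (Q,Q)_{β,H_{L,t}} − (Re⟨Q⟩_{β,H_{L,t}})²]`,
  `Q = Δ_d + Δ_d†`, `H_{L,t} = dWaveSourceTorus L U μ t = hubbardTorusWith 2 L 1 U μ − tQ`,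

throughout the thermal disc `|t| ≤ 1/β` is SUFFICIENT for the crux. This file proves the converse
AT ZERO SOURCE, for every finite torus and with explicit constants, so that the interacting
pair-susceptibility law is also NECESSARY: the crux cannot be easier than it.

* `twNec_partitionFn_re_le_of_gain_le` — (abstract: Hermitian `H`, `A` on `ℂⁿ`) a quadratic bound on
  the pressure gain, `log Z_β(H − tA) − log Z_β(H) ≤ βKt²` for all real `t`, is exactly GAUSSIAN
  DOMINATION `Z_β(H − tA + Kt²) ≤ Z_β(H)` in the sense of Dyson–Lieb–Simon;
* `twNec_duhamel_re_le_of_gain_le` — hence, by the tree's discharge of [DLS1978] eq. (44)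
  (`Matrix.gaussianDomination_duhamel_le_holds`: second-order expansion of `t ↦ tr e^{−β(H−tA)}`),
  the INFRARED BOUND `Re (A,A)_{β,H} ≤ 2K/β` — the sharp constant (`gain = χt²/2 + O(t⁴)`);
* `twNec_re_gibbsState_source_nonneg` / `twNec_re_gibbsState_source_le_of_gain_le` — (abstract,
  `⟨A⟩_{β,H} = 0`) the sourced magnetisation `m(t) = Re⟨A⟩_{β,H−tA}` obeys `0 ≤ m(t) ≤ 4Kt` for
  `t > 0`: two Peierls–Bogoliubov inequalities, `βt·m(t) ≥ log Z(H−tA) − log Z(H) ≥ 0` and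
  `βt·m(t) ≤ log Z(H−2tA) − log Z(H−tA) ≤ 4βKt²` (no differentiation needed);
* `tw_zeroSourceSusceptibility_of_inertness` — ON THE TORUS: `TwSourcedInertness` implies, with the
  SAME `U₀, a` and the constant `2C`, the zero-source susceptibility law
  `χ_L(β,μ,U,0) ≤ 2C(1 + log β)` for `0 < U ≤ U₀`, `1 ≤ β ≤ e^{a/U}`, `μ ∈ [μ₁,μ₂]`, `L ≥ L₀`
  (the `t = 0` slice of the hypothesis of `stub_discCorrection_of_discSusceptibility` /
  `tw_thermalDisc_of_discSusceptibility`);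
* `tw_sourcedPairAmplitude_of_inertness` — and the LINEAR RESPONSE BOUND on the induced anomalous
  density: `0 ≤ Re⟨Δ_d + Δ_d†⟩_{β,H_{L,t}}/L² ≤ 4C(1 + log β)·t` for every `t > 0`, same range.

So, up to the constant `2` and the restriction to `t = 0`, the crux and the KMB pair-susceptibility
law of the weakly repulsive Hubbard torus at `U log β ≤ a` are EQUIVALENT; for `t ≠ 0` inside the
disc only the integrated (magnetisation) form is implied, which is the expected content of a
convex, even pressure lying under a parabola. No definition is introduced; nothing is assumed.

Sources: F. J. Dyson, E. H. Lieb, B. Simon, J. Stat. Phys. 18 (1978) 335, §3 eq. (5) and §4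
eq. (44) [DLS1978]; O. Bratteli, D. W. Robinson, *Operator Algebras and QSM II* (1997) §5.3
(Peierls–Bogoliubov) [BratteliRobinsonII1997]; T. Koma, H. Tasaki, PRL 68 (1992) 3248, eqs. (5)–(8)
(gauge rotation, `⟨Δ_d + Δ_d†⟩_{K₀} = 0`) [KomaTasakiPRL1992]. Tree:
`Matrix.gaussianDomination_duhamel_le_holds` (`DuhamelTwoPointProofs`), `partitionFn_add_smul_one`,
`partitionFn_re_pos`, `isHermitian_sub_smul`, `log_partitionFn_sub_le_log_partitionFn_add`
(`ApproximatingHamiltonianProofs`), `gibbsState_hubbardTorusWith_pairSource`,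
`log_partitionFn_zero_le` (`TwSourcedCondensation.Negative.SourceResponseStructure`),
`isHermitian_hubbardTorusWith`, `cast_sq_pos_of_neZero` (`DWaveSourceProofs`).
-/

set_option linter.dupNamespace false

noncomputable section

namespace Summit.HubbardSuperconductivity.HubbardSuperconductivity.Theorems

open Matrix Finset Literature.MathematicalPhysics.QuantumLattice
open Literature.Probability.LatticeModels
open Summit.HubbardSuperconductivity.HubbardSuperconductivity.Theses.ThermalWedge
open Summit.HubbardSuperconductivity.HubbardSuperconductivity.Theorems.TwSourcedCondensation.Negative
open scoped Matrix.Norms.L2Operator ComplexOrder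

/-! ### Abstract: a quadratic gain bound is Gaussian domination, hence an infrared bound -/

section Abstract

variable {m : Type} [Fintype m] [DecidableEq m] [Nonempty m]

/-- **A quadratic pressure-gain bound is Gaussian domination.** For Hermitian `H`, `A`, if
`log Z_β(H − tA) − log Z_β(H) ≤ βKt²` for all real `t`, then
`Re Z_β(H − tA + (t²·(2K)/2)·1) ≤ Re Z_β(H)` for all real `t` (the hypothesis of
`Matrix.gaussianDomination_duhamel_le` with `Q = 2K`). [cite: DLS1978, eq. (43)–(44)] -/
theorem twNec_partitionFn_re_le_of_gain_le {H A : Matrix m m ℂ} (hH : H.IsHermitian)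
    (hA : A.IsHermitian) {β K : ℝ}
    (hgain : ∀ t : ℝ, Real.log (partitionFn β (H - (t : ℂ) • A)).re -
      Real.log (partitionFn β H).re ≤ β * K * t ^ 2) (t : ℝ) :
    (partitionFn β (H - (t : ℂ) • A + ((t ^ 2 * (2 * K) / 2 : ℝ) : ℂ) • 1)).re ≤
      (partitionFn β H).re := by
  have hHt : (H - (t : ℂ) • A).IsHermitian := isHermitian_sub_smul hH hA t
  have hZt : 0 < (partitionFn β (H - (t : ℂ) • A)).re := partitionFn_re_pos hHt β
  have hZ0 : 0 < (partitionFn β H).re := partitionFn_re_pos hH β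
  have h1 : Real.log (partitionFn β (H - (t : ℂ) • A)).re ≤
      Real.log (partitionFn β H).re + β * K * t ^ 2 := by linarith [hgain t]
  have h2 : (partitionFn β (H - (t : ℂ) • A)).re ≤
      (partitionFn β H).re * Real.exp (β * K * t ^ 2) := by
    calc (partitionFn β (H - (t : ℂ) • A)).re
        = Real.exp (Real.log (partitionFn β (H - (t : ℂ) • A)).re) := (Real.exp_log hZt).symm
      _ ≤ Real.exp (Real.log (partitionFn β H).re + β * K * t ^ 2) := Real.exp_le_exp.2 h1
      _ = (partitionFn β H).re * Real.exp (β * K * t ^ 2) := by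
          rw [Real.exp_add, Real.exp_log hZ0]
  have h3 : Real.exp (-(β * (t ^ 2 * (2 * K) / 2))) = (Real.exp (β * K * t ^ 2))⁻¹ := by
    rw [← Real.exp_neg]
    congr 1
    ring
  rw [partitionFn_add_smul_one, Complex.re_ofReal_mul, h3, inv_mul_le_iff₀ (Real.exp_pos _)]
  linarith [mul_comm ((partitionFn β H).re) (Real.exp (β * K * t ^ 2))]

/-- **Infrared bound from a quadratic gain bound** (`β > 0`): if
`log Z_β(H − tA) − log Z_β(H) ≤ βKt²` for all real `t` then the Duhamel two-point function obeys
`Re (A,A)_{β,H} ≤ 2K/β` — the sharp constant, since `log Z_β(H − tA) − log Z_β(H) = β²(A,A)t²/2 + O(t⁴)`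
when `⟨A⟩ = 0`. Proof: the previous lemma and the tree's discharge
`Matrix.gaussianDomination_duhamel_le_holds` of [DLS1978] eq. (44). [cite: DLS1978, eq. (44)] -/
theorem twNec_duhamel_re_le_of_gain_le {H A : Matrix m m ℂ} (hH : H.IsHermitian)
    (hA : A.IsHermitian) {β K : ℝ} (hβ : 0 < β)
    (hgain : ∀ t : ℝ, Real.log (partitionFn β (H - (t : ℂ) • A)).re -
      Real.log (partitionFn β H).re ≤ β * K * t ^ 2) :
    (duhamel β H A A).re ≤ 2 * K / β :=
  gaussianDomination_duhamel_le_holds m β hβ H A hH hA (2 * K)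
    (fun t => twNec_partitionFn_re_le_of_gain_le hH hA hgain t)

omit [Fintype m] [DecidableEq m] [Nonempty m] in
/-- Bookkeeping: `H − tA + (−s)A = H − (t + s)A`. [folklore] -/
theorem twNec_sub_smul_add_neg_smul (H A : Matrix m m ℂ) (t s : ℝ) :
    H - (t : ℂ) • A + (-(s : ℂ)) • A = H - ((t + s : ℝ) : ℂ) • A := by
  push_cast
  module

omit [Fintype m] [DecidableEq m] [Nonempty m] in
/-- Bookkeeping: `H − tA + tA = H`. [folklore] -/
theorem twNec_sub_smul_add_smul (H A : Matrix m m ℂ) (t : ℝ) :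
    H - (t : ℂ) • A + (t : ℂ) • A = H := by
  module

/-- **Peierls–Bogoliubov, lower side**: `log Z_β(H − tA) − log Z_β(H) ≤ βt·Re⟨A⟩_{β,H−tA}`
(tangent at the endpoint `H − tA` towards `H`). [cite: BratteliRobinsonII1997, §5.3] -/
theorem twNec_gain_le_mul_re_gibbsState_source {H A : Matrix m m ℂ} (hH : H.IsHermitian)
    (hA : A.IsHermitian) (β t : ℝ) :
    Real.log (partitionFn β (H - (t : ℂ) • A)).re - Real.log (partitionFn β H).re ≤
      β * (t * (gibbsState β (H - (t : ℂ) • A) A).re) := by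
  have hHt : (H - (t : ℂ) • A).IsHermitian := isHermitian_sub_smul hH hA t
  have hW : ((t : ℂ) • A).IsHermitian := isHermitian_real_smul hA t
  have hPB := log_partitionFn_sub_le_log_partitionFn_add hHt hW β
  rw [twNec_sub_smul_add_smul, map_smul, smul_eq_mul, Complex.re_ofReal_mul] at hPB
  linarith

/-- **Peierls–Bogoliubov, upper side**: `βs·Re⟨A⟩_{β,H−tA} ≤ log Z_β(H − (t+s)A) − log Z_β(H − tA)`
(tangent at `H − tA` towards `H − (t+s)A`). [cite: BratteliRobinsonII1997, §5.3] -/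
theorem twNec_mul_re_gibbsState_source_le_gain_sub {H A : Matrix m m ℂ} (hH : H.IsHermitian)
    (hA : A.IsHermitian) (β t s : ℝ) :
    β * (s * (gibbsState β (H - (t : ℂ) • A) A).re) ≤
      Real.log (partitionFn β (H - ((t + s : ℝ) : ℂ) • A)).re -
        Real.log (partitionFn β (H - (t : ℂ) • A)).re := by
  have hHt : (H - (t : ℂ) • A).IsHermitian := isHermitian_sub_smul hH hA t
  have hW : ((-(s : ℂ)) • A).IsHermitian := by
    rw [← Complex.ofReal_neg]
    exact isHermitian_real_smul hA (-s)
  have hPB := log_partitionFn_sub_le_log_partitionFn_add hHt hW β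
  rw [twNec_sub_smul_add_neg_smul, map_smul, smul_eq_mul, ← Complex.ofReal_neg,
    Complex.re_ofReal_mul] at hPB
  linarith

/-- **The sourced magnetisation of a centred observable is non-negative for positive sources**:
if `⟨A⟩_{β,H} = 0` then `0 ≤ Re⟨A⟩_{β,H−tA}` for `t > 0` (`β > 0`). Indeed
`βt·Re⟨A⟩_{H−tA} ≥ log Z(H−tA) − log Z(H) ≥ −βt·Re⟨A⟩_H = 0` by Peierls–Bogoliubov twice.
[cite: DLS1978, §3] -/
theorem twNec_re_gibbsState_source_nonneg {H A : Matrix m m ℂ} (hH : H.IsHermitian)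
    (hA : A.IsHermitian) {β : ℝ} (hβ : 0 < β) (h0 : (gibbsState β H A).re = 0) {t : ℝ}
    (ht : 0 < t) : 0 ≤ (gibbsState β (H - (t : ℂ) • A) A).re := by
  have h1 := twNec_gain_le_mul_re_gibbsState_source hH hA β t
  have h2 := twNec_mul_re_gibbsState_source_le_gain_sub hH hA β 0 t
  simp only [Complex.ofReal_zero, zero_smul, sub_zero, zero_add, h0, mul_zero] at h2
  have h3 : 0 ≤ β * (t * (gibbsState β (H - (t : ℂ) • A) A).re) := le_trans h2 h1
  have h4 : 0 ≤ t * (gibbsState β (H - (t : ℂ) • A) A).re := by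
    by_contra hneg
    push Not at hneg
    have := mul_neg_of_pos_of_neg hβ hneg
    linarith
  by_contra hneg
  push Not at hneg
  have := mul_neg_of_pos_of_neg ht hneg
  linarith

/-- **Linear magnetisation bound from a quadratic gain bound**: if `⟨A⟩_{β,H} = 0` and
`log Z_β(H − tA) − log Z_β(H) ≤ βKt²` for all real `t`, then `Re⟨A⟩_{β,H−tA} ≤ 4Kt` for `t > 0`
(`β > 0`): `βt·Re⟨A⟩_{H−tA} ≤ log Z(H−2tA) − log Z(H−tA) ≤ log Z(H−2tA) − log Z(H) ≤ 4βKt²`.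
[cite: DLS1978, §3] -/
theorem twNec_re_gibbsState_source_le_of_gain_le {H A : Matrix m m ℂ} (hH : H.IsHermitian)
    (hA : A.IsHermitian) {β K : ℝ} (hβ : 0 < β) (h0 : (gibbsState β H A).re = 0)
    (hgain : ∀ t : ℝ, Real.log (partitionFn β (H - (t : ℂ) • A)).re -
      Real.log (partitionFn β H).re ≤ β * K * t ^ 2) {t : ℝ} (ht : 0 < t) :
    (gibbsState β (H - (t : ℂ) • A) A).re ≤ 4 * K * t := by
  -- upper tangent at `H - tA` towards `H - 2tA`
  have h1 := twNec_mul_re_gibbsState_source_le_gain_sub hH hA β t t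
  -- `log Z(H) ≤ log Z(H - tA)` (lower tangent at `H`, centred observable)
  have h2 := twNec_mul_re_gibbsState_source_le_gain_sub hH hA β 0 t
  simp only [Complex.ofReal_zero, zero_smul, sub_zero, zero_add, h0, mul_zero] at h2
  -- the quadratic bound at `2t`
  have h3 := hgain (t + t)
  have h4 : β * (t * (gibbsState β (H - (t : ℂ) • A) A).re) ≤ β * K * (t + t) ^ 2 := by
    linarith
  have h5 : β * K * (t + t) ^ 2 = β * (t * (4 * K * t)) := by ring
  rw [h5] at h4
  have h6 : t * (gibbsState β (H - (t : ℂ) • A) A).re ≤ t * (4 * K * t) :=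
    le_of_mul_le_mul_left h4 hβ
  exact le_of_mul_le_mul_left h6 ht

end Abstract

/-! ### The torus: zero-source susceptibility and linear pair-amplitude response from the crux -/

section Torus

variable (L : ℕ) [NeZero L]

/-- **The crux in gain form on one torus.** If `p̃_L(h) − p̃_L(0) ≤ C(1 + log β)h²` for all real `h`
(`β > 0`), then, with `H = hubbardTorusWith 2 L 1 U μ`, `Q = Δ_d + Δ_d†`,
`log Z_β(H − tQ) − log Z_β(H) ≤ β·(L²C(1 + log β))·t²` for all real `t`. [folklore] -/
theorem twNec_gain_le_of_pressure_le {β : ℝ} (hβ : 0 < β) (U μ : ℝ) {C' : ℝ}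
    (hp : ∀ h : ℝ,
      Real.log (partitionFn β (dWaveSourceTorus L U μ h)).re / (β * (L : ℝ) ^ 2) -
        Real.log (partitionFn β (dWaveSourceTorus L U μ 0)).re / (β * (L : ℝ) ^ 2) ≤ C' * h ^ 2)
    (t : ℝ) :
    Real.log (partitionFn β (hubbardTorusWith 2 L 1 U μ -
        (t : ℂ) • (pairField dWaveFormFactor L + (pairField dWaveFormFactor L)ᴴ))).re -
      Real.log (partitionFn β (hubbardTorusWith 2 L 1 U μ)).re ≤
        β * ((L : ℝ) ^ 2 * C') * t ^ 2 := by
  have hL : (0 : ℝ) < (L : ℝ) ^ 2 := cast_sq_pos_of_neZero L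
  have hden : 0 < β * (L : ℝ) ^ 2 := mul_pos hβ hL
  have h := hp t
  rw [← sub_div, div_le_iff₀ hden, dWaveSourceTorus_zero] at h
  have hKt : dWaveSourceTorus L U μ t = hubbardTorusWith 2 L 1 U μ -
      (t : ℂ) • (pairField dWaveFormFactor L + (pairField dWaveFormFactor L)ᴴ) := rfl
  rw [hKt] at h
  calc Real.log (partitionFn β (hubbardTorusWith 2 L 1 U μ -
        (t : ℂ) • (pairField dWaveFormFactor L + (pairField dWaveFormFactor L)ᴴ))).re -
      Real.log (partitionFn β (hubbardTorusWith 2 L 1 U μ)).re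
      ≤ C' * t ^ 2 * (β * (L : ℝ) ^ 2) := h
    _ = β * ((L : ℝ) ^ 2 * C') * t ^ 2 := by ring

/-- **Zero-source susceptibility on one torus.** Under the same hypothesis,
`χ_L(β,μ,U,0) = (β/L²)[Re (Q,Q)_{β,H} − (Re⟨Q⟩_{β,H})²] ≤ 2C'`. [cite: DLS1978, eq. (44)] -/
theorem twNec_susceptibility_le_of_pressure_le {β : ℝ} (hβ : 0 < β) (U μ : ℝ) {C' : ℝ}
    (hp : ∀ h : ℝ,
      Real.log (partitionFn β (dWaveSourceTorus L U μ h)).re / (β * (L : ℝ) ^ 2) -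
        Real.log (partitionFn β (dWaveSourceTorus L U μ 0)).re / (β * (L : ℝ) ^ 2) ≤ C' * h ^ 2) :
    β / (L : ℝ) ^ 2 *
        ((duhamel β (dWaveSourceTorus L U μ 0)
            (pairField dWaveFormFactor L + (pairField dWaveFormFactor L)ᴴ)
            (pairField dWaveFormFactor L + (pairField dWaveFormFactor L)ᴴ)).re -
          (gibbsState β (dWaveSourceTorus L U μ 0)
            (pairField dWaveFormFactor L + (pairField dWaveFormFactor L)ᴴ)).re ^ 2) ≤
      2 * C' := by
  have hL : (0 : ℝ) < (L : ℝ) ^ 2 := cast_sq_pos_of_neZero L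
  have hHK := isHermitian_hubbardTorusWith L 1 U μ
  have hQ := isHermitian_pairField_add_conjTranspose L
  have hgain := twNec_gain_le_of_pressure_le L hβ U μ hp
  have hD := twNec_duhamel_re_le_of_gain_le hHK hQ hβ hgain
  rw [dWaveSourceTorus_zero]
  have hsq := sq_nonneg (gibbsState β (hubbardTorusWith 2 L 1 U μ)
    (pairField dWaveFormFactor L + (pairField dWaveFormFactor L)ᴴ)).re
  have hcoef : 0 ≤ β / (L : ℝ) ^ 2 := div_nonneg hβ.le hL.le
  calc β / (L : ℝ) ^ 2 *
        ((duhamel β (hubbardTorusWith 2 L 1 U μ)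
            (pairField dWaveFormFactor L + (pairField dWaveFormFactor L)ᴴ)
            (pairField dWaveFormFactor L + (pairField dWaveFormFactor L)ᴴ)).re -
          (gibbsState β (hubbardTorusWith 2 L 1 U μ)
            (pairField dWaveFormFactor L + (pairField dWaveFormFactor L)ᴴ)).re ^ 2)
      ≤ β / (L : ℝ) ^ 2 * (2 * ((L : ℝ) ^ 2 * C') / β) :=
        mul_le_mul_of_nonneg_left (by linarith) hcoef
    _ = 2 * C' := by
        have hL1 : (L : ℝ) ≠ 0 := by exact_mod_cast NeZero.ne L
        field_simp

/-- **Linear pair-amplitude response on one torus.** Under the same hypothesis, for every `t > 0`: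
`0 ≤ Re⟨Δ_d + Δ_d†⟩_{β,H_{L,t}}/L² ≤ 4C'·t`. [cite: DLS1978, §3] -/
theorem twNec_pairAmplitude_of_pressure_le {β : ℝ} (hβ : 0 < β) (U μ : ℝ) {C' : ℝ}
    (hp : ∀ h : ℝ,
      Real.log (partitionFn β (dWaveSourceTorus L U μ h)).re / (β * (L : ℝ) ^ 2) -
        Real.log (partitionFn β (dWaveSourceTorus L U μ 0)).re / (β * (L : ℝ) ^ 2) ≤ C' * h ^ 2)
    {t : ℝ} (ht : 0 < t) :
    0 ≤ (gibbsState β (dWaveSourceTorus L U μ t)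
          (pairField dWaveFormFactor L + (pairField dWaveFormFactor L)ᴴ)).re / (L : ℝ) ^ 2 ∧
      (gibbsState β (dWaveSourceTorus L U μ t)
          (pairField dWaveFormFactor L + (pairField dWaveFormFactor L)ᴴ)).re / (L : ℝ) ^ 2 ≤
        4 * C' * t := by
  have hL : (0 : ℝ) < (L : ℝ) ^ 2 := cast_sq_pos_of_neZero L
  have hHK := isHermitian_hubbardTorusWith L 1 U μ
  have hQ := isHermitian_pairField_add_conjTranspose L
  have hgain := twNec_gain_le_of_pressure_le L hβ U μ hp
  have h0 : (gibbsState β (hubbardTorusWith 2 L 1 U μ)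
      (pairField dWaveFormFactor L + (pairField dWaveFormFactor L)ᴴ)).re = 0 := by
    rw [gibbsState_hubbardTorusWith_pairSource, Complex.zero_re]
  have hKt : dWaveSourceTorus L U μ t = hubbardTorusWith 2 L 1 U μ -
      (t : ℂ) • (pairField dWaveFormFactor L + (pairField dWaveFormFactor L)ᴴ) := rfl
  rw [hKt]
  refine ⟨div_nonneg (twNec_re_gibbsState_source_nonneg hHK hQ hβ h0 ht) hL.le, ?_⟩
  rw [div_le_iff₀ hL]
  have h := twNec_re_gibbsState_source_le_of_gain_le hHK hQ hβ h0 hgain ht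
  calc (gibbsState β (hubbardTorusWith 2 L 1 U μ -
          (t : ℂ) • (pairField dWaveFormFactor L + (pairField dWaveFormFactor L)ᴴ))
          (pairField dWaveFormFactor L + (pairField dWaveFormFactor L)ᴴ)).re
      ≤ 4 * ((L : ℝ) ^ 2 * C') * t := h
    _ = 4 * C' * t * (L : ℝ) ^ 2 := by ring

end Torus

/-! ### The quantified statements: necessity of the susceptibility law for `TwSourcedInertness` -/

/-- **The zero-source pair-susceptibility law is necessary for the crux.** `TwSourcedInertness`
implies: for every compact `[μ₁,μ₂] ⊂ (−4,0)` there are `U₀, a, C > 0` (the crux's own `U₀, a`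
and twice its `C`) such that for `0 < U ≤ U₀`, `1 ≤ β ≤ e^{a/U}`, `μ ∈ [μ₁,μ₂]`, eventually in
`L`, the Kubo–Mori–Bogoliubov `d`-wave pair susceptibility of the source-free torus Gibbs state
obeys `χ_L(β,μ,U,0) = (β/L²)[Re (Q,Q)_{β,H_{L,0}} − (Re⟨Q⟩_{β,H_{L,0}})²] ≤ C(1 + log β)`,
`Q = Δ_d + Δ_d†` — the `t = 0` slice of the hypothesis of `tw_thermalDisc_of_discSusceptibility`
and `stub_discCorrection_of_discSusceptibility`. [cite: DLS1978, eq. (44)] -/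
theorem tw_zeroSourceSusceptibility_of_inertness :
    Summit.HubbardSuperconductivity.HubbardSuperconductivity.Theses.ThermalWedge.TwSourcedInertness →
    ∀ μ₁ μ₂ : ℝ, -4 < μ₁ → μ₁ ≤ μ₂ → μ₂ < 0 → ∃ U₀ a C : ℝ, 0 < U₀ ∧ 0 < a ∧ 0 < C ∧
      ∀ U : ℝ, 0 < U → U ≤ U₀ → ∀ β : ℝ, 1 ≤ β → β ≤ Real.exp (a / U) → ∀ μ ∈ Set.Icc μ₁ μ₂,
        ∃ L₀ : ℕ, ∀ (L : ℕ) [NeZero L], L₀ ≤ L →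
          β / (L : ℝ) ^ 2 *
            ((Matrix.duhamel β
                (Literature.MathematicalPhysics.QuantumLattice.dWaveSourceTorus L U μ 0)
                (Literature.MathematicalPhysics.QuantumLattice.pairField
                  Literature.MathematicalPhysics.QuantumLattice.dWaveFormFactor L +
                  (Literature.MathematicalPhysics.QuantumLattice.pairField
                    Literature.MathematicalPhysics.QuantumLattice.dWaveFormFactor L)ᴴ)
                (Literature.MathematicalPhysics.QuantumLattice.pairField
                  Literature.MathematicalPhysics.QuantumLattice.dWaveFormFactor L +
                  (Literature.MathematicalPhysics.QuantumLattice.pairField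
                    Literature.MathematicalPhysics.QuantumLattice.dWaveFormFactor L)ᴴ)).re -
              (Matrix.gibbsState β
                (Literature.MathematicalPhysics.QuantumLattice.dWaveSourceTorus L U μ 0)
                (Literature.MathematicalPhysics.QuantumLattice.pairField
                  Literature.MathematicalPhysics.QuantumLattice.dWaveFormFactor L +
                  (Literature.MathematicalPhysics.QuantumLattice.pairField
                    Literature.MathematicalPhysics.QuantumLattice.dWaveFormFactor L)ᴴ)).re ^ 2) ≤
            C * (1 + Real.log β) := by
  intro hI μ₁ μ₂ h1 h12 h2
  obtain ⟨U₀, a, C, hU₀, ha, hC, hU⟩ := hI μ₁ μ₂ h1 h12 h2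
  refine ⟨U₀, a, 2 * C, hU₀, ha, by positivity, fun U hU0 hUU₀ β hβ1 hβa μ hμ => ?_⟩
  obtain ⟨L₀, hL₀⟩ := hU U hU0 hUU₀ β hβ1 hβa μ hμ
  refine ⟨L₀, fun L _ hL => ?_⟩
  have hβ : 0 < β := lt_of_lt_of_le one_pos hβ1
  have h := twNec_susceptibility_le_of_pressure_le L hβ U μ (C' := C * (1 + Real.log β))
    (fun h => hL₀ L hL h)
  calc _ ≤ 2 * (C * (1 + Real.log β)) := h
    _ = 2 * C * (1 + Real.log β) := by ring

/-- **The linear pair-amplitude response bound is necessary for the crux.** `TwSourcedInertness`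
implies: for every compact `[μ₁,μ₂] ⊂ (−4,0)` there are `U₀, a, C > 0` (the crux's `U₀, a` and four
times its `C`) such that for `0 < U ≤ U₀`, `1 ≤ β ≤ e^{a/U}`, `μ ∈ [μ₁,μ₂]`, eventually in `L`, and
every source `t > 0`, the induced anomalous `d`-wave density of the sourced torus Gibbs state obeys
`0 ≤ Re⟨Δ_d + Δ_d†⟩_{β,H_{L,t}}/L² ≤ C(1 + log β)·t`. [cite: DLS1978, §3] -/
theorem tw_sourcedPairAmplitude_of_inertness :
    Summit.HubbardSuperconductivity.HubbardSuperconductivity.Theses.ThermalWedge.TwSourcedInertness →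
    ∀ μ₁ μ₂ : ℝ, -4 < μ₁ → μ₁ ≤ μ₂ → μ₂ < 0 → ∃ U₀ a C : ℝ, 0 < U₀ ∧ 0 < a ∧ 0 < C ∧
      ∀ U : ℝ, 0 < U → U ≤ U₀ → ∀ β : ℝ, 1 ≤ β → β ≤ Real.exp (a / U) → ∀ μ ∈ Set.Icc μ₁ μ₂,
        ∃ L₀ : ℕ, ∀ (L : ℕ) [NeZero L], L₀ ≤ L → ∀ t : ℝ, 0 < t →
          0 ≤ (Matrix.gibbsState β
                (Literature.MathematicalPhysics.QuantumLattice.dWaveSourceTorus L U μ t)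
                (Literature.MathematicalPhysics.QuantumLattice.pairField
                  Literature.MathematicalPhysics.QuantumLattice.dWaveFormFactor L +
                  (Literature.MathematicalPhysics.QuantumLattice.pairField
                    Literature.MathematicalPhysics.QuantumLattice.dWaveFormFactor L)ᴴ)).re /
              (L : ℝ) ^ 2 ∧
          (Matrix.gibbsState β
                (Literature.MathematicalPhysics.QuantumLattice.dWaveSourceTorus L U μ t)
                (Literature.MathematicalPhysics.QuantumLattice.pairField
                  Literature.MathematicalPhysics.QuantumLattice.dWaveFormFactor L +
                  (Literature.MathematicalPhysics.QuantumLattice.pairField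
                    Literature.MathematicalPhysics.QuantumLattice.dWaveFormFactor L)ᴴ)).re /
              (L : ℝ) ^ 2 ≤
            C * (1 + Real.log β) * t := by
  intro hI μ₁ μ₂ h1 h12 h2
  obtain ⟨U₀, a, C, hU₀, ha, hC, hU⟩ := hI μ₁ μ₂ h1 h12 h2
  refine ⟨U₀, a, 4 * C, hU₀, ha, by positivity, fun U hU0 hUU₀ β hβ1 hβa μ hμ => ?_⟩
  obtain ⟨L₀, hL₀⟩ := hU U hU0 hUU₀ β hβ1 hβa μ hμ
  refine ⟨L₀, fun L _ hL t ht => ?_⟩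
  have hβ : 0 < β := lt_of_lt_of_le one_pos hβ1
  have h := twNec_pairAmplitude_of_pressure_le L hβ U μ (C' := C * (1 + Real.log β))
    (fun h => hL₀ L hL h) ht
  refine ⟨h.1, ?_⟩
  calc _ ≤ 4 * (C * (1 + Real.log β)) * t := h.2
    _ = 4 * C * (1 + Real.log β) * t := by ring

end Summit.HubbardSuperconductivity.HubbardSuperconductivity.Theorems
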